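import Mathlib
import Summits.ValiantsHypothesis.ValiantsHypothesis.Theses.GrenetZeon
import Summits.ValiantsHypothesis.ValiantsHypothesis.Theorems.GrenetZeonTwoDimCoefficientsDefs
import Summits.ValiantsHypothesis.ValiantsHypothesis.Theorems.GrenetZeonTwoDimCoefficientsDualUnipotentNormalForm
import Summits.ValiantsHypothesis.ValiantsHypothesis.Theorems.GrenetZeonTwoDimCoefficientsDualUnipotentLevelFlat

/-!
# `GrenetZeon.DualUnipotentThreeHalves` (stmt-ValiantsHypothesis-24318), line «wild_portrait» head F:
# the stub F2 `CheapParameterMass` IS the rung — `CheapParameterMass ↔ DualUnipotentThreeHalves`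

Negative knowledge for the 3/2 rung (refuter val-neg-2, Negative lane, 2026-08-28).  The ideator line
`Cruxes/DualUnipotentThreeHalves/Lines/wild_portrait.lean` (val-idea-9, critic PASS-WITH-PRICE) reduces the rung to
`CheapIndexMass ∨ CheapParameterMass`.  Its F head is CIRCULAR: the stub F2 `WildMass.CheapParameterMass`

  `∃ C n₀, ∀ n ≥ n₀, ∀ m, DualUnipotentRepr n m → ∃ N M lev g K, N M affine ∧ per_n = tr(N^{n−1} M) ∧ N block-upper for lev ∧`
  `lev < g ∧ (diagonal constituents still along K) ∧ g·⌊√n⌋ ≤ C(m + ⌊√n⌋) ∧ n² ≤ dim K + C·m·⌊√n⌋`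

is EQUIVALENT to the rung `∃ C n₀, ∀ n ≥ n₀, ∀ m, DualUnipotentRepr n m → n³ ≤ C m²` (`cheapParameterMass_iff_dualUnipotentThreeHalves`).

* (←, `cheapParameterMass_of_dualUnipotentThreeHalves`, the new direction) the witness `lev ≡ 0`, `g = 1`, `K = ⊥` on the
  nilpotent-pencil normal form (`exists_nilpotent_pencil_of_dualUnipotentRepr`, p589181) satisfies every structural clause
  VACUOUSLY, and the two inequalities collapse to `⌊√n⌋ ≤ C(m + ⌊√n⌋)` and `n² ≤ C·m·⌊√n⌋` — the latter is the rung's inequality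
  (`n³ ≤ C₀ m²` gives `n⁴ ≤ 3C₀ m² ⌊√n⌋²`, so `C = 3C₀ + 1` works).  The critic's vacuity check (VERDICT #2 (ii)) excluded the
  `K = ⊤` escape only; the `K = ⊥` escape is free.
* (→, `dualUnipotentThreeHalves_of_cheapParameterMass`) is the skeleton's own composition, Theorems-side: F1
  `finrank_le_of_diagStill` (p-landed `…DualUnipotentLevelFlat`) bounds `dim K ≤ 2gn ≤ 2C(m + ⌊√n⌋)n/⌊√n⌋`, i.e. the `dim K` credit F2
  may claim is NEVER larger than its own slack term `O(C·m·√n)`; so F2 holds at `(n, m)` iff `n² ≲ C m √n` iff the rung's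
  inequality holds there.

Consequence for the line: F2 is not a reduction of the rung and not a crux; `CheapIndexMass ∨ CheapParameterMass → rung` is
`CheapIndexMass ∨ rung → rung`.  (U2 `CheapIndexMass` does NOT collapse this way: by unfolding, every block form has index mass
`≥ n^{3/2}/12`, and `≤ C·m` additionally forces near-triangularisability at width `m` — a structural claim the rung does not give.)
The PORTRAIT inequality F1 itself is untouched and remains citable.  Statements are inlined (Theorems-side vocabulary of
`…DualUnipotentLevelFlat`); the displayed F2 body is `Iff.rfl`-equal to `WildMass.CheapParameterMass` of the skeleton.

HONEST FRAMING: nothing here proves or refutes the rung, `stub_dualUnipotent`, the crux 8062, or moves `VP ≠ VNP`.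
-/

set_option linter.dupNamespace false
set_option autoImplicit false

noncomputable section

namespace Summit.ValiantsHypothesis.ValiantsHypothesis.Theorems.DualUnipotentThreeHalvesNegative

open MvPolynomial Matrix
open scoped BigOperators
open Literature.Computability.AlgebraicComplexity
open Summit.ValiantsHypothesis.ValiantsHypothesis.Cruxes.TwoDimCoefficients.DimTwoCases
  (AffMat IsAffine DualUnipotentRepr exists_nilpotent_pencil_of_dualUnipotentRepr finrank_le_of_diagStill)
open Summit.ValiantsHypothesis.ValiantsHypothesis.Theses.GrenetZeon (DualUnipotentThreeHalves)

/-- **RUNG ⇒ F2 (the `K = ⊥`, one-level witness).**  If the 3/2 rung holds then `CheapParameterMass` holds: on the normal-form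
pencil take the trivial block form (`lev ≡ 0`, `g = 1`) and the zero still-space `K = ⊥`; all structural clauses are vacuous and
`n² ≤ 0 + C·m·⌊√n⌋` is the rung's inequality. [folklore] -/
theorem cheapParameterMass_of_dualUnipotentThreeHalves (h : DualUnipotentThreeHalves) :
    ∃ C n₀ : ℕ, ∀ n ≥ n₀, ∀ m : ℕ, DualUnipotentRepr n m →
      ∃ (N M : AffMat n m) (lev : Fin m → ℕ) (g : ℕ) (K : Submodule ℂ (Fin n × Fin n → ℂ)),
        IsAffine N ∧ IsAffine M ∧ perPoly (Fin n) ℂ = (N ^ (n - 1) * M).trace ∧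
        (∀ i j : Fin m, lev j < lev i → N i j = 0) ∧ (∀ u : Fin m, lev u < g) ∧
        (∀ v ∈ K, ∀ i j : Fin m, lev i = lev j →
          ∑ c, v c * MvPolynomial.coeff (Finsupp.single c 1) (N i j) = 0) ∧
        g * Nat.sqrt n ≤ C * (m + Nat.sqrt n) ∧ n ^ 2 ≤ Module.finrank ℂ K + C * m * Nat.sqrt n := by
  obtain ⟨C₀, n₀, hC⟩ := h
  refine ⟨3 * C₀ + 1, max n₀ 1, ?_⟩
  intro n hn m hrep
  have hn₀ : n₀ ≤ n := le_trans (le_max_left _ _) hn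
  have hn1 : 1 ≤ n := le_trans (le_max_right _ _) hn
  have hcube : n ^ 3 ≤ C₀ * m ^ 2 := hC n hn₀ m hrep
  obtain ⟨N, M, hN, hM, -, hper⟩ := exists_nilpotent_pencil_of_dualUnipotentRepr hn1 hrep
  refine ⟨N, M, fun _ => 0, 1, ⊥, fun i j => (hN i j).totalDegree_le, fun i j => (hM i j).totalDegree_le, hper,
    fun i j hij => absurd hij (lt_irrefl 0), fun _ => Nat.zero_lt_one, ?_, ?_, ?_⟩
  · intro v hv i j _
    rw [Submodule.mem_bot] at hv
    subst hv
    simp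
  · nlinarith [Nat.zero_le (Nat.sqrt n), Nat.zero_le m, Nat.zero_le C₀]
  · rw [finrank_bot, zero_add]
    set s := Nat.sqrt n with hs
    have hs2 : n < (s + 1) ^ 2 := Nat.lt_succ_sqrt' n
    have hs0 : 1 ≤ s := Nat.succ_le_of_lt (Nat.sqrt_pos.2 (by omega))
    -- `n ≤ 3 s²`
    have hn3 : n ≤ 3 * s ^ 2 := by nlinarith [hs2, hs0]
    -- `(n²)² ≤ ((3C₀+1) m s)²`
    have h4 : (n ^ 2) * (n ^ 2) ≤ ((3 * C₀ + 1) * m * s) * ((3 * C₀ + 1) * m * s) := by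
      have e1 : n ^ 2 * n ^ 2 = n ^ 3 * n := by ring
      have e2 : n ^ 3 * n ≤ (C₀ * m ^ 2) * (3 * s ^ 2) := Nat.mul_le_mul hcube hn3
      have e3 : (C₀ * m ^ 2) * (3 * s ^ 2) ≤ ((3 * C₀ + 1) * m * s) * ((3 * C₀ + 1) * m * s) := by
        have : 3 * C₀ ≤ (3 * C₀ + 1) * (3 * C₀ + 1) := by nlinarith
        nlinarith [Nat.zero_le (m ^ 2 * s ^ 2), this]
      calc (n ^ 2) * (n ^ 2) = n ^ 3 * n := e1
        _ ≤ (C₀ * m ^ 2) * (3 * s ^ 2) := e2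
        _ ≤ ((3 * C₀ + 1) * m * s) * ((3 * C₀ + 1) * m * s) := e3
    exact Nat.mul_self_le_mul_self_iff.1 h4

/-- **F2 ⇒ RUNG** (the skeleton's composition `WildMass.dualUnipotentThreeHalves_of levelFlat_proof`, Theorems-side through F1
`finrank_le_of_diagStill`): `dim K ≤ 2gn`, `n² ≤ 2gn + C m s`, `g s ≤ C(m + s)`, `s = ⌊√n⌋` give `n³ ≤ 144 C² m²` for `n ≥ 4C`.
[folklore] -/
theorem dualUnipotentThreeHalves_of_cheapParameterMass
    (h : ∃ C n₀ : ℕ, ∀ n ≥ n₀, ∀ m : ℕ, DualUnipotentRepr n m →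
      ∃ (N M : AffMat n m) (lev : Fin m → ℕ) (g : ℕ) (K : Submodule ℂ (Fin n × Fin n → ℂ)),
        IsAffine N ∧ IsAffine M ∧ perPoly (Fin n) ℂ = (N ^ (n - 1) * M).trace ∧
        (∀ i j : Fin m, lev j < lev i → N i j = 0) ∧ (∀ u : Fin m, lev u < g) ∧
        (∀ v ∈ K, ∀ i j : Fin m, lev i = lev j →
          ∑ c, v c * MvPolynomial.coeff (Finsupp.single c 1) (N i j) = 0) ∧
        g * Nat.sqrt n ≤ C * (m + Nat.sqrt n) ∧ n ^ 2 ≤ Module.finrank ℂ K + C * m * Nat.sqrt n) :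
    DualUnipotentThreeHalves := by
  obtain ⟨C, n₀, hC⟩ := h
  refine ⟨144 * C ^ 2, max n₀ (max 4 (4 * C)), ?_⟩
  intro n hn m hrep
  have hn₀ : n₀ ≤ n := le_trans (le_max_left _ _) hn
  have hn4 : 4 ≤ n := le_trans (le_trans (le_max_left _ _) (le_max_right _ _)) hn
  have hnC : 4 * C ≤ n := le_trans (le_trans (le_max_right _ _) (le_max_right _ _)) hn
  have hrep' : DualUnipotentRepr n m := hrep
  obtain ⟨N, M, lev, g, K, hN, hM, hper, hup, hg, hK, hgs, hmass⟩ := hC n hn₀ m hrep'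
  have hdim : Module.finrank ℂ K ≤ 2 * g * n := finrank_le_of_diagStill N M lev K hN hM hup hg hper hK
  set s := Nat.sqrt n with hs
  have hs1 : s ^ 2 ≤ n := Nat.sqrt_le' n
  have hs2 : n < (s + 1) ^ 2 := Nat.lt_succ_sqrt' n
  have hs0 : 1 ≤ s := Nat.succ_le_of_lt (Nat.sqrt_pos.2 (by omega))
  have hn0 : 0 < n := by omega
  have h0 : n ^ 2 ≤ 2 * g * n + C * m * s := le_trans hmass (Nat.add_le_add_right hdim _)
  have h1 : s * n ^ 2 ≤ n * (3 * C * m + 2 * C * s) := by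
    have e1 : s * n ^ 2 ≤ s * (2 * g * n + C * m * s) := Nat.mul_le_mul_left s h0
    have e2 : 2 * (g * s) * n ≤ 2 * (C * (m + s)) * n :=
      Nat.mul_le_mul_right n (Nat.mul_le_mul_left 2 hgs)
    have e3 : C * m * (s * s) ≤ C * m * n := Nat.mul_le_mul_left (C * m) (by nlinarith [hs1])
    nlinarith [e1, e2, e3]
  have h2 : s * n ≤ 3 * C * m + 2 * C * s := by
    have h1' : n * (s * n) ≤ n * (3 * C * m + 2 * C * s) := by nlinarith [h1]
    exact Nat.le_of_mul_le_mul_left h1' hn0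
  have h3 : s * n ≤ 6 * C * m := by nlinarith [h2, hnC, Nat.mul_le_mul_left s hnC]
  have h4 : (s * n) * (s * n) ≤ (6 * C * m) * (6 * C * m) := Nat.mul_le_mul h3 h3
  have hs3 : n ≤ 4 * s ^ 2 := by nlinarith [hs2, hs0]
  have h5 : n * n ^ 2 ≤ (4 * s ^ 2) * n ^ 2 := Nat.mul_le_mul_right (n ^ 2) hs3
  nlinarith [h4, h5]

/-- **F2 ≡ RUNG.**  The stub `CheapParameterMass` of the line «wild_portrait» (head F) is equivalent to the rung
`DualUnipotentThreeHalves`: it is the rung in costume, not a reduction of it. [folklore] -/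
theorem cheapParameterMass_iff_dualUnipotentThreeHalves :
    (∃ C n₀ : ℕ, ∀ n ≥ n₀, ∀ m : ℕ, DualUnipotentRepr n m →
      ∃ (N M : AffMat n m) (lev : Fin m → ℕ) (g : ℕ) (K : Submodule ℂ (Fin n × Fin n → ℂ)),
        IsAffine N ∧ IsAffine M ∧ perPoly (Fin n) ℂ = (N ^ (n - 1) * M).trace ∧
        (∀ i j : Fin m, lev j < lev i → N i j = 0) ∧ (∀ u : Fin m, lev u < g) ∧
        (∀ v ∈ K, ∀ i j : Fin m, lev i = lev j →
          ∑ c, v c * MvPolynomial.coeff (Finsupp.single c 1) (N i j) = 0) ∧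
        g * Nat.sqrt n ≤ C * (m + Nat.sqrt n) ∧ n ^ 2 ≤ Module.finrank ℂ K + C * m * Nat.sqrt n) ↔
    DualUnipotentThreeHalves :=
  ⟨dualUnipotentThreeHalves_of_cheapParameterMass, cheapParameterMass_of_dualUnipotentThreeHalves⟩

end Summit.ValiantsHypothesis.ValiantsHypothesis.Theorems.DualUnipotentThreeHalvesNegative

end
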